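import Summits.ResolutionOfSingularities.ResolutionOfSingularities.Theorems.MarkedTransferCampaignW46WWalkNRExit
import Summits.ResolutionOfSingularities.ResolutionOfSingularities.Theorems.MarkedTransferCampaignW46WWalkCombinatorics
import HarnessLib

/-!
# [OURS · L1 W4.6 rung (iii-2), NON-RATIONAL W-WALK, brick 10] THE TAIL THEOREM OVER AN ARBITRARY GROUND FIELD (door-free): the same
# argument as brick 8 with the boundary exponents and the end of the rational tail taken from the EXACT exit (`…WWalkNRExit`)

Cell `res-hironaka`, LADDER-RESOLUTION rung L (D-0089), slot W4.6 rung (iii); seat res-L1-s46-pv-6 (gen 8). Host route MarkedTransfer,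
`--supports stmt-ResolutionOfSingularities-16155 --as helper`; kind proof (no definition).

WHAT. `tail_false_exit` (imperfect-`K` road, res-L1-s46-pv-5's `W-WALK-PLAN.md` §7.2(c)): brick 8's `tail_false` VERBATIM but with NO
perfectness of the ground field — the two places where brick 8 used the approximate door (`bdiv_lt_of_wAnchor`, `false_of_rational_tail`) are
replaced by `…WWalkNRExit.bdiv_lt_of_wAnchor_exit` / `false_of_rational_tail_exit` (limit curve + Krull + completion exit). The order bound is
carried inside the per-stage hypothesis. ORIGINAL DESCRIPTION (brick 8) — `tail_false`: there is no sequence of `Ω`-residuals `g_n` (`n ≥ 0`) carried by `w`-anchors over perfect fields `L_n ↪ Ω` (images `Λ_n`) at the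
points `y_{κ n}` of a hit thread of a §2.1-permissible sequence inside o1's regime `regimeMohWindowSurfaceInsep`, related by `T`-steps
`g_{n+1} = stepT p l_n γ_n g_n` with pv-5's boundary bookkeeping, field data `Λ_n ≤ Λ_{n+1} ∋ l_n, γ_n`, `l_n ∈ Λ_n ⇒ Λ_{n+1} ≤ Λ_n`, and minimal
polynomials of the `l_n` over `Λ_n` (irreducible, separable). PROOF (HOME/L/res-L1-s46-pv-6/NOTES-g8 §Math): the shade `σ_n = d_n − r_t − r_y` is
non-increasing (pv-5 `shade_succ_le`), eventually `= s`. `s ≥ p + 1`: `d` grows — impossible. `s < p`: (ND) holds, so by the W-DEGREE LAW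
(`…WWalkNRBaseChange.natDegree_mul_shade_le`) a non-rational digit would halve the shade — all digits are eventually rational and
`…WWalkNRDescent.false_of_rational_tail` (pv-5's door) ends it. `s = p` (plateau, `d` eventually constant `= D`, no `y`-letter): if (ND) holds
from some point on, the same; otherwise a DEFECT stage has degree-`D` form `c₀ t^{D−p} z^p` (`…WWalkNRPoint.coeff_eq_zero_of_not_ndz`), the defect
PERSISTS (`…WWalkNRDescent.defect_step`), and the SHADOW residuals `(z^p + g_n)(1 + c₀ t^{D−p})⁻¹ − z^p` form a tail of the same kind with all
orders `≥ D + 1` (`tail_step`); induction on `2p − 1 − D`.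

HONEST FRAMING. OURS; nothing here is a statement of H. Hironaka's manuscript [Hironaka2017] and nothing of it is used. AI-written;
AI review is weaker than expert review. No `sorry`; axioms standard. [cite: Hauser2010, §§F–G] [cite: StacksProject, Tag 00DV] [folklore]
-/

noncomputable section

set_option linter.dupNamespace false -- mandated namespace of this single-conjunct summit

open MvPowerSeries IsLocalRing Finset
open Literature.AlgebraicGeometry.Resolution
open Literature.RingTheory.MvPowerSeries.Jets (mem_maximalIdeal_iff_constantCoeff_eq_zero mem_maximalIdeal_pow_iff)

namespace Summit.ResolutionOfSingularities.ResolutionOfSingularities.Theorems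

namespace CampaignW46

namespace WWalkNR

open CategoryTheory AlgebraicGeometry TopologicalSpace
open Literature.AlgebraicGeometry.Hironaka2017.S02Preliminaries
open Literature.AlgebraicGeometry.Hironaka2017.Datum
open Scheme.IdealSheafData
open WWalk
open MohWindowShadeFormalNR (order_map_of_injective)

section Tail

variable {p : ℕ} [hp : Fact p.Prime] {K : Type} [Field K] [CharP K p]
  {Ω : Type} [Field Ω] [DecidableEq Ω] [CharP Ω p]

/-- **THE TAIL STEP, any ground field.** [OURS · L1 W4.6 rung (iii-2)] NOT a statement of the manuscript. A `T`-tail of the non-rational W-walk with all orders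
`≥ 2p − 1 − q` either does not exist or produces (on a defective `σ = p` plateau) a SHADOW tail of the same kind with all orders `≥ 2p − q`.
[cite: Hauser2010, §§F–G] [cite: StacksProject, Tag 00DV] -/
theorem tail_step_exit (r : PermissibleRun p K) (hr : ∀ k, regimeMohWindowSurfaceInsep (p := p) (K := K) (r.A k) (r.E k)) (t : r.HitThread)
    (q : ℕ) (κ : ℕ → ℕ) (g : ℕ → MvPowerSeries (Option (Fin 2)) Ω) (rt ry : ℕ → ℕ) (Λ : ℕ → Subfield Ω) (l γ : ℕ → Ω)
    (hA : ∀ n, ∃ (L : Type) (_ : Field L) (_ : CharP L p) (ι : L →+* Ω)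
      (e : AdicCompletion (maximalIdeal ((r.A (κ n)).Z.presheaf.stalk (t.y (κ n)))) ((r.A (κ n)).Z.presheaf.stalk (t.y (κ n))) ≃+*
        MvPowerSeries (Option (Fin 2)) L) (f₀ : (r.A (κ n)).Z.presheaf.stalk (t.y (κ n))) (w fL : MvPowerSeries (Option (Fin 2)) L),
      ι.fieldRange = Λ n ∧ stalkIdeal (r.E (κ n)).J (t.y (κ n)) = Ideal.span {f₀} ∧ IsUnit w ∧ e (algebraMap _ _ f₀) = w * (X none ^ p + fL) ∧
        MvPowerSeries.map ι fL = g n)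
    (hLB : ∀ n, (LowVanish (p + 1) (g n) ∧ BDiv (rt n) (ry n) (g n)) ∧ 2 * p - 1 - q ≤ (g n).order.toNat)
    (hstep : ∀ n, g (n + 1) = stepT p (l n) (γ n) (g n) ∧ rt (n + 1) = (g n).order.toNat - p ∧
      ry (n + 1) = (if l n = 0 then ry n else 0) ∧ (l n = 0 → 0 < ry n → γ n = 0))
    (hΛ : ∀ n, Λ n ≤ Λ (n + 1) ∧ γ n ∈ Λ (n + 1) ∧ l n ∈ Λ (n + 1) ∧ (l n ∈ Λ n → Λ (n + 1) ≤ Λ n))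
    (hπ : ∀ n, ∃ π : Polynomial (Λ n), Irreducible π ∧ π.Separable ∧ (π.map (Λ n).subtype).IsRoot (l n)) :
    ∃ (κ' : ℕ → ℕ) (g' : ℕ → MvPowerSeries (Option (Fin 2)) Ω) (rt' ry' : ℕ → ℕ) (Λ' : ℕ → Subfield Ω) (l' γ' : ℕ → Ω),
      (∀ n, ∃ (L : Type) (_ : Field L) (_ : CharP L p) (ι : L →+* Ω)
        (e : AdicCompletion (maximalIdeal ((r.A (κ' n)).Z.presheaf.stalk (t.y (κ' n)))) ((r.A (κ' n)).Z.presheaf.stalk (t.y (κ' n))) ≃+*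
          MvPowerSeries (Option (Fin 2)) L) (f₀ : (r.A (κ' n)).Z.presheaf.stalk (t.y (κ' n))) (w fL : MvPowerSeries (Option (Fin 2)) L),
        ι.fieldRange = Λ' n ∧ stalkIdeal (r.E (κ' n)).J (t.y (κ' n)) = Ideal.span {f₀} ∧ IsUnit w ∧ e (algebraMap _ _ f₀) = w * (X none ^ p + fL) ∧
          MvPowerSeries.map ι fL = g' n) ∧
      (∀ n, (LowVanish (p + 1) (g' n) ∧ BDiv (rt' n) (ry' n) (g' n)) ∧ 2 * p - 1 - q + 1 ≤ (g' n).order.toNat) ∧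
      (∀ n, g' (n + 1) = stepT p (l' n) (γ' n) (g' n) ∧ rt' (n + 1) = (g' n).order.toNat - p ∧
        ry' (n + 1) = (if l' n = 0 then ry' n else 0) ∧ (l' n = 0 → 0 < ry' n → γ' n = 0)) ∧
      (∀ n, Λ' n ≤ Λ' (n + 1) ∧ γ' n ∈ Λ' (n + 1) ∧ l' n ∈ Λ' (n + 1) ∧ (l' n ∈ Λ' n → Λ' (n + 1) ≤ Λ' n)) ∧
      (∀ n, ∃ π : Polynomial (Λ' n), Irreducible π ∧ π.Separable ∧ (π.map (Λ' n).subtype).IsRoot (l' n)) := by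
  classical
  have hp2 : 2 ≤ p := hp.out.two_le
  -- per-stage facts through the anchors
  have facts : ∀ n, ∃ d : ℕ, (g n).order = d ∧ p + 1 ≤ d ∧ d ≤ 2 * p - 1 ∧ LowVanish d (g n) ∧
      (∃ a b c, a + b + c = d ∧ coeff (mk3 a b c) (g n) ≠ 0) ∧ (d - rt n - ry n < p → NDz d (g n)) := by
    intro n
    obtain ⟨L, _iF, _iC, ι, e, f₀, w, fL, -, hJ, hw, hE, hfL⟩ := hA n
    have hP2L : LowVanish (p + 1) fL := (lowVanish_map_iff ι (p + 1) fL).mp (by rw [hfL]; exact (hLB n).1.1)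
    have hBL : BDiv (rt n) (ry n) fL := (bdiv_map_iff ι (rt n) (ry n) fL).mp (by rw [hfL]; exact (hLB n).1.2)
    obtain ⟨d, hd, hpd, hd2, hlow, ⟨a, b, c, habc, hne⟩, hnd⟩ := residual_facts (hr (κ n)) (t.mem (κ n)) e hJ hw hE hP2L hBL
    refine ⟨d, by rw [← hfL, order_map_of_injective ι ι.injective, hd], hpd, hd2, by rw [← hfL]; exact (lowVanish_map_iff ι d fL).mpr hlow,
      ⟨a, b, c, habc, by rw [← hfL, MvPowerSeries.coeff_map, map_ne_zero_iff ι ι.injective]; exact hne⟩, fun h => ?_⟩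
    rw [← hfL]
    exact (ndz_map_iff ι d fL).mpr (hnd h)
  have hiso : ∀ n, rt n < p ∧ ry n < p := by
    intro n
    obtain ⟨L, _iF, _iC, ι, e, f₀, w, fL, -, hJ, hw, hE, hfL⟩ := hA n
    have hBL : BDiv (rt n) (ry n) fL := (bdiv_map_iff ι (rt n) (ry n) fL).mp (by rw [hfL]; exact (hLB n).1.2)
    exact bdiv_lt_of_wAnchor_exit (hr (κ n)) e hJ hw hE hBL
  have hdefect : ∀ (n d : ℕ), (g n).order = d → ¬ NDz d (g n) → ∀ a b c, a + b + c = d → c < p → coeff (mk3 a b c) (g n) = 0 := by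
    intro n d hd hnd a b c habc hc
    obtain ⟨L, _iF, _iC, ι, e, f₀, w, fL, -, hJ, hw, hE, hfL⟩ := hA n
    have hP2L : LowVanish (p + 1) fL := (lowVanish_map_iff ι (p + 1) fL).mp (by rw [hfL]; exact (hLB n).1.1)
    have hdL : fL.order = d := by rw [← order_map_of_injective ι ι.injective, hfL, hd]
    have hndL : ¬ NDz d fL := fun h => hnd (by rw [← hfL]; exact (ndz_map_iff ι d fL).mpr h)
    have h := coeff_eq_zero_of_not_ndz (hr (κ n)) (t.mem (κ n)) e hJ hw hE hP2L hdL hndL habc hc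
    rw [← hfL, MvPowerSeries.coeff_map, h, map_zero]
  have hcoefmem : ∀ n e', coeff e' (g n) ∈ Λ n := by
    intro n e'
    obtain ⟨L, _iF, _iC, ι, e, f₀, w, fL, hΛn, -, -, -, hfL⟩ := hA n
    rw [← hΛn, ← hfL]
    exact coeff_map_mem ι fL e'
  have hΛmono : ∀ a b, a ≤ b → Λ a ≤ Λ b := by
    intro a b hab
    induction hab with
    | refl => exact le_rfl
    | step _ ih => exact ih.trans (hΛ _).1
  choose dM hdM using facts
  have hdto : ∀ n, (g n).order.toNat = dM n := fun n => by rw [(hdM n).1]; rfl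
  have hwin : ∀ n, p + 1 ≤ dM n ∧ dM n ≤ 2 * p - 1 := fun n => ⟨(hdM n).2.1, (hdM n).2.2.1⟩
  have hrt : ∀ n, rt (n + 1) = dM n - p := fun n => by rw [(hstep n).2.1, hdto]
  have hsum : ∀ n, rt n + ry n ≤ dM n := fun n =>
    rt_add_ry_le g rt ry dM (fun j => (hLB j).1.2) (fun j => (hdM j).2.2.2.2.1) n
  -- the shade is non-increasing, eventually constant
  set σ : ℕ → ℕ := fun n => dM n - rt n - ry n with hσ
  have hmono : ∀ n, σ (n + 1) ≤ σ n := fun n =>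
    shade_succ_le g rt ry dM (fun j => (hLB j).1.2) (fun j => (hdM j).2.2.2.1) (fun j => (hdM j).2.2.2.2.1) (fun _ => false) l γ hwin
      (fun j _ => ⟨(hstep j).1, hrt j, (hstep j).2.2.1, (hstep j).2.2.2⟩) (fun j h => (Bool.false_ne_true h).elim) n
  obtain ⟨N₀, hN₀⟩ := exists_eventually_const_of_antitone σ hmono
  -- THE DEGREE LAW at a non-rational digit
  have hdeg_law : ∀ n, l n ∉ Λ n → NDz (dM n) (g n) → 2 * (dM (n + 1) - (dM n - p)) ≤ dM n - rt n - ry n := by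
    intro n hl hnd
    obtain ⟨π, hirr, hsep, hroot⟩ := hπ n
    obtain ⟨g₀, hg₀⟩ := exists_eq_map_of_coeff_mem (Λ n).subtype (g n) (fun e' => by
      obtain ⟨x, hx⟩ : ∃ x : Λ n, (x : Ω) = coeff e' (g n) := ⟨⟨_, hcoefmem n e'⟩, rfl⟩
      exact ⟨x, hx⟩)
    have hm : 2 ≤ π.natDegree := two_le_natDegree_of_root_not_mem hirr hroot hl
    have hl0 : l n ≠ 0 := fun h => hl (by rw [h]; exact (Λ n).zero_mem)
    have hB₀ : BDiv (rt n) (ry n) g₀ := (bdiv_map_iff (Λ n).subtype (rt n) (ry n) g₀).mp (by rw [hg₀]; exact (hLB n).1.2)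
    have hlow₀ : LowVanish (dM n) g₀ := (lowVanish_map_iff (Λ n).subtype (dM n) g₀).mp (by rw [hg₀]; exact (hdM n).2.2.2.1)
    have hnd₀ : NDz (dM n) g₀ := (ndz_map_iff (Λ n).subtype (dM n) g₀).mp (by rw [hg₀]; exact hnd)
    have hlow' : LowVanish (dM (n + 1)) (stepT p (l n) (γ n) (MvPowerSeries.map (Λ n).subtype g₀)) := by
      rw [hg₀, ← (hstep n).1]; exact (hdM (n + 1)).2.2.2.1
    have h := natDegree_mul_shade_le (Λ n).subtype (hwin n).1 (hwin n).2 hB₀ hlow₀ hirr hsep hroot hl0 (γ n) hnd₀ hlow'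
    calc 2 * (dM (n + 1) - (dM n - p)) ≤ π.natDegree * (dM (n + 1) - (dM n - p)) := Nat.mul_le_mul_right _ hm
      _ ≤ dM n - rt n - ry n := h
  -- rationality from a stage, then descent
  have hdescent : ∀ M, (∀ n, M ≤ n → l n ∈ Λ n) → False := by
    intro M hrat
    obtain ⟨L, _iF, _iC, ι, e, f₀, w, fL, hΛM, hJ, hw, hE, hfL⟩ := hA M
    obtain ⟨⟨hisoM, -⟩, hbM⟩ := (regimeMohWindowSurfaceInsep_iff _ _).mp (hr (κ M))
    exact false_of_rational_tail_exit hisoM hbM M g Λ l γ ⟨L, _iF, _iC, ι, e, f₀, w, fL, hΛM, hJ, hw, hE, hfL⟩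
      (fun n _ e' he' => (hLB n).1.1 e' (by omega)) (fun n _ => (hstep n).1) (fun n _ => ⟨(hΛ n).2.1, (hΛ n).2.2.1, (hΛ n).2.2.2⟩) hrat
  set s := σ N₀ with hs
  have hσN : ∀ n, N₀ ≤ n → dM n - rt n - ry n = s := fun n hn => hN₀ n hn
  -- case analysis on the eventual shade
  rcases Nat.lt_or_ge s p with hslt | hsge
  · -- `s < p`: all digits rational from `N₀`
    exfalso
    refine hdescent N₀ fun n hn => ?_
    by_contra hl
    have hnd : NDz (dM n) (g n) := (hdM n).2.2.2.2.2 (by rw [hσN n hn]; exact hslt)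
    have h1 := hdeg_law n hl hnd
    have hl0 : l n ≠ 0 := fun h => hl (by rw [h]; exact (Λ n).zero_mem)
    have hry : ry (n + 1) = 0 := by rw [(hstep n).2.2.1, if_neg hl0]
    have h2 := hσN (n + 1) (by omega)
    have h3 := hσN n hn
    have h4 := hrt n
    have h5 := hsum (n + 1)
    have h6 := (hwin (n + 1)).1
    have h7 := (hwin n).2
    omega
  rcases hsge.lt_or_eq with hsgt | hseq
  · -- `s ≥ p + 1`: the order grows without bound
    exfalso
    have hgrow : ∀ j, dM (N₀ + j) ≥ dM N₀ + j := by
      intro j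
      induction j with
      | zero => simp
      | succ j ih =>
        have h2 := hσN (N₀ + j + 1) (by omega)
        have h4 := hrt (N₀ + j)
        have h5 := hsum (N₀ + j + 1)
        have h6 := (hwin (N₀ + j)).1
        rw [show N₀ + (j + 1) = N₀ + j + 1 by omega]
        omega
    have h := hgrow (2 * p)
    have h' := (hwin (N₀ + 2 * p)).2
    omega
  · -- `s = p`: the plateau
    have hdsucc : ∀ n, N₀ ≤ n → dM (n + 1) = dM n + ry (n + 1) := by
      intro n hn
      have h2 := hσN (n + 1) (by omega)
      have h4 := hrt n
      have h5 := hsum (n + 1)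
      have h6 := (hwin n).1
      rw [← hseq] at h2
      omega
    -- `d` is non-decreasing and bounded: eventually constant
    obtain ⟨N₁', hN₁'⟩ := exists_eventually_const_of_antitone (fun j => 2 * p - dM (N₀ + j)) (fun j => by
      show 2 * p - dM (N₀ + (j + 1)) ≤ 2 * p - dM (N₀ + j)
      have h := hdsucc (N₀ + j) (by omega)
      rw [show N₀ + (j + 1) = N₀ + j + 1 by omega]
      have := (hwin (N₀ + j + 1)).2
      omega)
    set D := dM (N₀ + N₁') with hD
    have hDn : ∀ n, N₀ + N₁' ≤ n → dM n = D := by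
      intro n hn
      obtain ⟨j, rfl⟩ : ∃ j, n = N₀ + j := ⟨n - N₀, by omega⟩
      have h := hN₁' j (by omega)
      have h1 := (hwin (N₀ + j)).2
      have h2 := (hwin (N₀ + N₁')).2
      omega
    set N₂ := N₀ + N₁' + 1 with hN₂
    have hryn : ∀ n, N₂ ≤ n → ry n = 0 := by
      intro n hn
      obtain ⟨m, rfl⟩ : ∃ m, n = m + 1 := ⟨n - 1, by omega⟩
      have h := hdsucc m (by omega)
      rw [hDn (m + 1) (by omega), hDn m (by omega)] at h
      omega
    have hrtn : ∀ n, N₂ ≤ n → rt n = D - p := by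
      intro n hn
      obtain ⟨m, rfl⟩ : ∃ m, n = m + 1 := ⟨n - 1, by omega⟩
      rw [hrt m, hDn m (by omega)]
    have hpD : p + 1 ≤ D := (hwin (N₀ + N₁')).1
    have hD2 : D ≤ 2 * p - 1 := (hwin (N₀ + N₁')).2
    by_cases hαβ : ∀ n, N₂ ≤ n → NDz D (g n)
    · -- (α): (ND) everywhere on the plateau ⇒ rational ⇒ descent
      exfalso
      refine hdescent N₂ fun n hn => ?_
      by_contra hl
      have hnd : NDz (dM n) (g n) := by rw [hDn n (by omega)]; exact hαβ n hn
      have h1 := hdeg_law n hl hnd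
      rw [hDn n (by omega), hDn (n + 1) (by omega), hrtn n hn, hryn n hn] at h1
      omega
    · -- (β): a defect stage `n₁`; the defect persists; the shadow tail
      push Not at hαβ
      obtain ⟨n₁, hn₁, hnd₁⟩ := hαβ
      have hdef₁ := hdefect n₁ D (by rw [(hdM n₁).1, hDn n₁ (by omega)]) hnd₁
      set c₀ := coeff (mk3 (D - p) 0 p) (g n₁) with hc₀
      -- persistence of the defect and of the corner coefficient
      have hlowD : ∀ n, N₂ ≤ n → LowVanish D (g n) := fun n hn => by rw [← hDn n (by omega)]; exact (hdM n).2.2.2.1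
      have hBD : ∀ n, N₂ ≤ n → BDiv (D - p) 0 (g n) := fun n hn => by rw [← hrtn n hn, ← hryn n hn]; exact (hLB n).1.2
      have hpers : ∀ j, (∀ a b c, a + b + c = D → c < p → coeff (mk3 a b c) (g (n₁ + j)) = 0) ∧ coeff (mk3 (D - p) 0 p) (g (n₁ + j)) = c₀ := by
        intro j
        induction j with
        | zero => exact ⟨hdef₁, rfl⟩
        | succ j ih =>
          have e1 : g (n₁ + (j + 1)) = stepT p (l (n₁ + j)) (γ (n₁ + j)) (g (n₁ + j)) := by
            rw [show n₁ + (j + 1) = n₁ + j + 1 by omega]; exact (hstep _).1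
          have e2 : g (n₁ + j + 1 + 1) = stepT p (l (n₁ + j + 1)) (γ (n₁ + j + 1)) (stepT p (l (n₁ + j)) (γ (n₁ + j)) (g (n₁ + j))) := by
            rw [(hstep (n₁ + j + 1)).1, (hstep (n₁ + j)).1]
          have h := defect_step hpD hD2 (hlowD (n₁ + j) (by omega)) (hBD (n₁ + j) (by omega)) (l (n₁ + j)) (γ (n₁ + j))
            (by rw [← e1]; exact hlowD (n₁ + (j + 1)) (by omega)) (by rw [← e1]; exact hBD (n₁ + (j + 1)) (by omega))
            (l (n₁ + j + 1)) (γ (n₁ + j + 1)) (by rw [← e2]; exact hlowD (n₁ + j + 1 + 1) (by omega)) ih.1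
          rw [e1]
          exact ⟨h.1, h.2.trans ih.2⟩
      have hcorner : ∀ j a b c, a + b + c = D → ¬ (a = D - p ∧ b = 0 ∧ c = p) → coeff (mk3 a b c) (g (n₁ + j)) = 0 := by
        intro j a b c habc hne
        by_cases hc : c < p
        · exact (hpers j).1 a b c habc hc
        · by_contra h0
          have h1 := (hBD (n₁ + j) (by omega)) _ h0
          simp only [mk3_t, mk3_y] at h1
          omega
      -- the shadow unit
      have hR : 1 ≤ D - p := by omega
      set u : MvPowerSeries (Option (Fin 2)) Ω := MvPowerSeries.C (1 : Ω) + MvPowerSeries.C c₀ * X (some 0) ^ (D - p) with hu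
      have huunit : IsUnit u := isUnit_one_add_C_mul_X_pow c₀ hR
      obtain ⟨uU, huU⟩ := huunit
      set v : MvPowerSeries (Option (Fin 2)) Ω := ↑uU⁻¹ with hv
      have huv : u * v = 1 := by rw [← huU, hv, Units.mul_inv]
      have huv' : (MvPowerSeries.C (1 : Ω) + MvPowerSeries.C c₀ * X (some 0) ^ (D - p)) * v = 1 := huv
      have hsubv : ∀ a b : Ω, subst (stepS a b) v = v := by
        intro a b
        have h1 : subst (stepS a b) u = u := by rw [hu]; exact subst_stepS_C_add_C_mul_X_pow a b 1 c₀ (D - p)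
        have h2 : u * subst (stepS a b) v = 1 := by
          rw [← h1, ← subst_mul (hasSubst_stepS a b), huv, ← substAlgHom_apply (hasSubst_stepS a b), map_one]
        have h3 : v * u = 1 := by rw [mul_comm]; exact huv
        exact (left_inv_eq_right_inv h3 h2).symm
      have hc₀mem : ∀ j, c₀ ∈ Λ (n₁ + j) := fun j => hΛmono n₁ (n₁ + j) (by omega) (hcoefmem n₁ _)
      -- the shadow data
      set g' : ℕ → MvPowerSeries (Option (Fin 2)) Ω := fun j => (X none ^ p + g (n₁ + j)) * v - X none ^ p with hg'
      have hg'eq : ∀ j, g' j = (g (n₁ + j) - MvPowerSeries.C c₀ * X (some 0) ^ (D - p) * X none ^ p) * v := by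
        intro j
        rw [hg']
        simp only
        rw [shadow_eq _ u v huv, hu, map_one, add_sub_cancel_left]
      have hg'low : ∀ j, LowVanish (D + 1) (g' j) := fun j => by
        rw [hg'eq]
        exact lowVanish_mul_right (lowVanish_sub_corner (by omega) (hlowD (n₁ + j) (by omega)) (hcorner j) (hpers j).2) v
      have hg'step : ∀ j, g' (j + 1) = stepT p (l (n₁ + j)) (γ (n₁ + j)) (g' j) := by
        intro j
        have h := stepT_twist (p := p) (l (n₁ + j)) (γ (n₁ + j)) (f := g (n₁ + j)) (fun e' he' => (hLB _).1.1 e' (by omega)) v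
        rw [hsubv, ← (hstep (n₁ + j)).1] at h
        have h2 : X none ^ p + g' (j + 1) = X none ^ p + stepT p (l (n₁ + j)) (γ (n₁ + j)) (g' j) := by
          rw [hg']
          simp only
          rw [h, show n₁ + (j + 1) = n₁ + j + 1 by omega]
          ring
        exact add_left_cancel h2
      -- anchors of the shadow
      have hA' : ∀ j, ∃ (L : Type) (_ : Field L) (_ : CharP L p) (ι : L →+* Ω)
          (e : AdicCompletion (maximalIdeal ((r.A (κ (n₁ + j))).Z.presheaf.stalk (t.y (κ (n₁ + j))))) ((r.A (κ (n₁ + j))).Z.presheaf.stalk (t.y (κ (n₁ + j)))) ≃+*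
            MvPowerSeries (Option (Fin 2)) L) (f₀ : (r.A (κ (n₁ + j))).Z.presheaf.stalk (t.y (κ (n₁ + j)))) (w fL : MvPowerSeries (Option (Fin 2)) L),
          ι.fieldRange = Λ (n₁ + j) ∧ stalkIdeal (r.E (κ (n₁ + j))).J (t.y (κ (n₁ + j))) = Ideal.span {f₀} ∧ IsUnit w ∧
            e (algebraMap _ _ f₀) = w * (X none ^ p + fL) ∧ MvPowerSeries.map ι fL = g' j := by
        intro j
        obtain ⟨L, _iF, _iC, ι, e, f₀, w, fL, hΛn, hJ, hw, hE, hfL⟩ := hA (n₁ + j)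
        obtain ⟨w', fL', hw', hE', hfL'⟩ := exists_shadow_anchor (p := p) ι (e := fun x => e x) hw hE hfL (by rw [hΛn]; exact hc₀mem j) hR huv'
        exact ⟨L, _iF, _iC, ι, e, f₀, w', fL', hΛn, hJ, hw', hE', hfL'⟩
      -- boundary bookkeeping of the shadow, and its per-stage facts
      let rt' : ℕ → ℕ := fun j => Nat.rec (D - p) (fun j _ => (g' j).order.toNat - p) j
      have hrt'0 : rt' 0 = D - p := rfl
      have hrt'succ : ∀ j, rt' (j + 1) = (g' j).order.toNat - p := fun j => rfl
      have hB' : ∀ j, BDiv (rt' j) (ry (n₁ + j)) (g' j) := by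
        intro j
        induction j with
        | zero =>
          rw [hrt'0, Nat.add_zero, hryn n₁ hn₁, hg'eq]
          exact bdiv_mul_right (bdiv_sub_corner (hBD n₁ hn₁) c₀) v
        | succ j ih =>
          obtain ⟨L, _iF, _iC, ι, e, f₀, w, fL, -, hJ, hw, hE, hfL⟩ := hA' j
          have hP2L : LowVanish (p + 1) fL := (lowVanish_map_iff ι (p + 1) fL).mp (by rw [hfL]; exact fun e' he' => hg'low j e' (by omega))
          have hBL : BDiv (rt' j) (ry (n₁ + j)) fL := (bdiv_map_iff ι _ _ fL).mp (by rw [hfL]; exact ih)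
          obtain ⟨d', hd', hpd', hd2', hlowd', -, -⟩ := residual_facts (hr (κ (n₁ + j))) (t.mem (κ (n₁ + j))) e hJ hw hE hP2L hBL
          have hd'Ω : (g' j).order = d' := by rw [← hfL, order_map_of_injective ι ι.injective, hd']
          have hdto' : (g' j).order.toNat = d' := by rw [hd'Ω]; rfl
          have hlow' : LowVanish d' (g' j) := by rw [← hfL]; exact (lowVanish_map_iff ι d' fL).mpr hlowd'
          rw [hrt'succ, hg'step, hdto', show n₁ + (j + 1) = n₁ + j + 1 by omega, (hstep (n₁ + j)).2.2.1]
          exact bdiv_stepT hlow' ih hpd' (by omega) (hstep (n₁ + j)).2.2.2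
      refine ⟨fun j => κ (n₁ + j), g', rt', fun j => ry (n₁ + j), fun j => Λ (n₁ + j), fun j => l (n₁ + j), fun j => γ (n₁ + j), hA',
        fun j => ⟨⟨fun e' he' => hg'low j e' (by omega), hB' j⟩, ?_⟩,
        fun j => ⟨hg'step j, hrt'succ j, by beta_reduce; rw [show n₁ + (j + 1) = n₁ + j + 1 by omega]; exact (hstep (n₁ + j)).2.2.1,
          (hstep (n₁ + j)).2.2.2⟩,
        fun j => by beta_reduce; rw [show n₁ + (j + 1) = n₁ + j + 1 by omega]; exact hΛ (n₁ + j), fun j => hπ (n₁ + j)⟩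
      -- the orders of the shadow are `≥ D + 1 ≥ 2p − q`
      obtain ⟨L, _iF, _iC, ι, e, f₀, w, fL, -, hJ, hw, hE, hfL⟩ := hA' j
      have hP2L : LowVanish (p + 1) fL := (lowVanish_map_iff ι (p + 1) fL).mp (by rw [hfL]; exact fun e' he' => hg'low j e' (by omega))
      have hBL : BDiv (rt' j) (ry (n₁ + j)) fL := (bdiv_map_iff ι _ _ fL).mp (by rw [hfL]; exact hB' j)
      obtain ⟨d', hd', -, -, -, -, -⟩ := residual_facts (hr (κ (n₁ + j))) (t.mem (κ (n₁ + j))) e hJ hw hE hP2L hBL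
      have hd'Ω : (g' j).order = d' := by rw [← hfL, order_map_of_injective ι ι.injective, hd']
      have hge : ((D + 1 : ℕ) : ℕ∞) ≤ (g' j).order := MvPowerSeries.nat_le_order fun e' he' => hg'low j e' (by exact_mod_cast he')
      rw [hd'Ω] at hge ⊢
      have h1 : D + 1 ≤ d' := by exact_mod_cast hge
      have h2 := (hLB n₁).2
      rw [hdto n₁, hDn n₁ (by omega)] at h2
      change 2 * p - 1 - q + 1 ≤ (d' : ℕ∞).toNat
      simp only [ENat.toNat_coe]
      omega

/-- **THE TAIL THEOREM, any ground field.** [OURS · L1 W4.6 rung (iii-2)] NOT a statement of the manuscript. No `T`-tail of the non-rational W-walk along a hit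
thread inside o1's regime `regimeMohWindowSurfaceInsep` exists (induction on `q` in the order bound `2p − 1 − q`, by `tail_step`; at `q = 0` the
shadow would have order `≥ 2p`, outside the window). [cite: Hauser2010, §§F–G] [cite: StacksProject, Tag 00DV] -/
theorem tail_false_exit (r : PermissibleRun p K) (hr : ∀ k, regimeMohWindowSurfaceInsep (p := p) (K := K) (r.A k) (r.E k)) (t : r.HitThread)
    (q : ℕ) : ∀ (κ : ℕ → ℕ) (g : ℕ → MvPowerSeries (Option (Fin 2)) Ω) (rt ry : ℕ → ℕ) (Λ : ℕ → Subfield Ω) (l γ : ℕ → Ω),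
    (∀ n, ∃ (L : Type) (_ : Field L) (_ : CharP L p) (ι : L →+* Ω)
      (e : AdicCompletion (maximalIdeal ((r.A (κ n)).Z.presheaf.stalk (t.y (κ n)))) ((r.A (κ n)).Z.presheaf.stalk (t.y (κ n))) ≃+*
        MvPowerSeries (Option (Fin 2)) L) (f₀ : (r.A (κ n)).Z.presheaf.stalk (t.y (κ n))) (w fL : MvPowerSeries (Option (Fin 2)) L),
      ι.fieldRange = Λ n ∧ stalkIdeal (r.E (κ n)).J (t.y (κ n)) = Ideal.span {f₀} ∧ IsUnit w ∧ e (algebraMap _ _ f₀) = w * (X none ^ p + fL) ∧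
        MvPowerSeries.map ι fL = g n) →
    (∀ n, (LowVanish (p + 1) (g n) ∧ BDiv (rt n) (ry n) (g n)) ∧ 2 * p - 1 - q ≤ (g n).order.toNat) →
    (∀ n, g (n + 1) = stepT p (l n) (γ n) (g n) ∧ rt (n + 1) = (g n).order.toNat - p ∧
      ry (n + 1) = (if l n = 0 then ry n else 0) ∧ (l n = 0 → 0 < ry n → γ n = 0)) →
    (∀ n, Λ n ≤ Λ (n + 1) ∧ γ n ∈ Λ (n + 1) ∧ l n ∈ Λ (n + 1) ∧ (l n ∈ Λ n → Λ (n + 1) ≤ Λ n)) →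
    (∀ n, ∃ π : Polynomial (Λ n), Irreducible π ∧ π.Separable ∧ (π.map (Λ n).subtype).IsRoot (l n)) → False := by
  classical
  induction q with
  | zero =>
    intro κ g rt ry Λ l γ hA hLB hstep hΛ hπ
    obtain ⟨κ', g', rt', ry', Λ', l', γ', hA', hLB', -, -, -⟩ := tail_step_exit r hr t 0 κ g rt ry Λ l γ hA hLB hstep hΛ hπ
    obtain ⟨L, _iF, _iC, ι, e, f₀, w, fL, -, hJ, hw, hE, hfL⟩ := hA' 0
    have hP2L : LowVanish (p + 1) fL := (lowVanish_map_iff ι (p + 1) fL).mp (by rw [hfL]; exact (hLB' 0).1.1)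
    have hBL : BDiv (rt' 0) (ry' 0) fL := (bdiv_map_iff ι _ _ fL).mp (by rw [hfL]; exact (hLB' 0).1.2)
    obtain ⟨d', hd', -, hd2', -, -, -⟩ := residual_facts (hr (κ' 0)) (t.mem (κ' 0)) e hJ hw hE hP2L hBL
    have h := (hLB' 0).2
    rw [← hfL, order_map_of_injective ι ι.injective, hd'] at h
    change 2 * p - 1 - 0 + 1 ≤ (d' : ℕ∞).toNat at h
    simp only [ENat.toNat_coe] at h
    have hp2 : 2 ≤ p := hp.out.two_le
    omega
  | succ q ih =>
    intro κ g rt ry Λ l γ hA hLB hstep hΛ hπ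
    obtain ⟨κ', g', rt', ry', Λ', l', γ', hA', hLB', hstep', hΛ', hπ'⟩ := tail_step_exit r hr t (q + 1) κ g rt ry Λ l γ hA hLB hstep hΛ hπ
    exact ih κ' g' rt' ry' Λ' l' γ' hA' (fun n => ⟨(hLB' n).1, by have := (hLB' n).2; omega⟩) hstep' hΛ' hπ'

end Tail

end WWalkNR

end CampaignW46

end Summit.ResolutionOfSingularities.ResolutionOfSingularities.Theorems

end
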